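import Summits.BirchSwinnertonDyer.Rank1Residual.X1.RankOneRiemannSumCertificate
import Literature.NumberTheory.EllipticCurves.Rank1Residual.X1CoeffOneRiemannSumIntegral
import HarnessLib

/-!
# Residual class X1 ∩ {r = 1}: the per-pair route with ONE numerical hypothesis —
# `p⁻ⁿ < ‖RS(1, n)‖_p` + `p ∤ #Ш_an` ⇒ Mazur's main conjecture ∧ `BSD(E,p)` on the rank-one leaf
# (the measure bound of `RankOneRiemannSumCertificate.lean` is free at `r_an = 1`; theorems only)

HONEST FRAMING (cell `b2b-bsdres`, run/shared/lean/b2b/bsd-rank1-residual/, verbatim in every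
file): the goal of the cell is to DELETE the COMBINATION-SHAPED residual classes of the
Birch–Swinnerton-Dyer formula for ALL analytic-rank `≤ 1` elliptic curves over `ℚ` — "full BSD
formula for every rank `≤ 1` curve in class `C`" assembled STRICTLY from published theorems — so
that the rank-`≤ 1` remainder becomes exactly the CONSTRUCTION-SHAPED classes, which are TYPED
(missing-input `Prop`s), NOT attempted. This is not "finishing BSD". Lane CLASS-CLOSURE
(coordinator ruling 2026-08-21T04:07:19Z): research routes; no claim beyond the stated classes;
census / instrument output is EVIDENCE, never a Literature fact; per-pair certificates are
INSTRUMENTATION (E4), never coverage. PER-PAIR certificate shape, not a class theorem; nothing is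
booked by this file; no label of `RESIDUAL-MAP.md` moves. Seat cc-typer-6 GEN 7 (typer of record
N1 / N1′ / N1″; pen of the N1-COEFF1 register `HOME/class-closure/N1/PREDICTIONS-N1COEFF1.md`).

WHAT THIS FILE ADDS to `X1/RankOneRiemannSumCertificate.lean` (p266737: measure bound `hC` + one
Riemann-sum inequality `hlt` ⇒ Schneider / MC ∧ BSDp on the leaf): on the rank-one leaf the measure
bound is a THEOREM with `C = 1` — `L(E,1) = 0` puts `{∞,0}_f` in the period lattice, so the
Mazur–Swinnerton-Dyer measure of the newform of `E` is `ℤ_p`-valued at the (odd, good ordinary) leaf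
prime (`norm_msdMeasure_unitRoot_le_one_of_analyticRank_eq_one`,
`Literature/…/Rank1Residual/X1CoeffOneRiemannSumIntegral.lean`). Hence:
* `Leaf.schneider_of_riemannSum_lt` — leaf pair, newform `f`, ONE level `n` with
  `p⁻ⁿ < ‖RS(1, n)‖_p` (`RS = padicLRiemannSum f (unitRoot W p) 1 n`, i.e. `v_p(RS(1,n)) < n`)
  ⇒ Schneider's non-degeneracy for every canonical height datum;
* `Leaf.mazurMainConjecture_and_bsdp_of_shaAn_unit_of_riemannSum_lt` /
  `Leaf.bsdp_of_shaAn_unit_of_riemannSum_lt` — + `p ∤ #Ш(E)_an` ⇒ Mazur's main conjecture ∧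
  `BSD(E,p)` (route B binders unchanged: Wuthrich 2014 Thm. 16, Schneider 1985 / BMS 1.7,
  Perrin-Riou 1987, Mazur–Tate sigma, modularity, GZK);
* `Leaf.bsdp_of_riemannSum_lt_of_isIsogenous_shaAn_unit` — booking form along the isogeny class.
What a row of the N1-COEFF1 instrument (verdict `NON-ZERO(v)` at level `n* = n + 1`, `c_den = 0`,
`K = n > v`) supplies is EVIDENCE for exactly `hlt` in the engines' `ω₁`-normalisation
(`x⁺_E = u_E·[·]⁺_f`, `|u_E|_p = 1` expected at good `p ≥ 5` — an instrument-dictionary statement,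
register ADDENDUM 5b (g2)); the former second gap (g2′, 'the denominator bound at every level') no
longer exists on this leaf. Nothing is discharged by this file; no cell changes colour.

References: [SteinWuthrich2013] §3 Prop. 3.1 / 3.5; [MazurTateTeitelbaum1986Invent] §I.8, §I.10;
[Wuthrich2014] Thm. 16; [PerrinRiou1987] §1.4 Cor. 1.8; [BalakrishnanMullerStein2015] Thm. 1.7;
[MilneADT2006] Thm. I.7.3.
-/

noncomputable section

open scoped Classical MatrixGroups ModularForm
open CongruenceSubgroup WeierstrassCurve PowerSeries Literature.NumberTheory.EllipticCurves
  Literature.NumberTheory.EllipticCurves.ModularForms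
  Literature.NumberTheory.EllipticCurves.Wuthrich2014
  Literature.NumberTheory.EllipticCurves.Rank1Residual
  Summit.BirchSwinnertonDyer.BirchSwinnertonDyer.Theorems
  Summit.BirchSwinnertonDyer.BirchSwinnertonDyer.Theorems.Rank1ResidualX1Defs

set_option autoImplicit false

namespace Summit.BirchSwinnertonDyer.Rank1Residual.X1.RankOne

variable {W : WeierstrassCurve ℚ} [W.IsElliptic] [W.IsGloballyMinimal] {p : ℕ} [Fact p.Prime]

/-- On the rank-one leaf the Mazur–Swinnerton-Dyer measure of the newform of `E` at the unit root is
`ℤ_p`-valued (`2 < p`, good ordinary, `r_an = 1` are leaf data).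
[cite: MazurTateTeitelbaum1986Invent, §I.8 (8.6) and §I.10] -/
theorem Leaf.norm_msdMeasure_unitRoot_le_one (h : Leaf W p) {N : ℕ} [NeZero N]
    (f : CuspForm (Gamma0 N) 2) (hf : IsNewformOf W f) (m : ℕ) (a : ZMod (p ^ m)) :
    ‖msdMeasure f (unitRoot W p : ℚ_[p]) m a‖ ≤ 1 :=
  norm_msdMeasure_unitRoot_le_one_of_analyticRank_eq_one (by have := h.two_lt; omega)
    h.isOrdinaryAt hf h.analyticRank_eq_one m a

/-- **Leaf pair + ONE Riemann-sum inequality ⇒ Schneider.** At a rank-one X1 leaf pair, `f` the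
newform of `E`: one level `n` with `p⁻ⁿ < ‖RS(1, n)‖_p` gives `[T¹]L_p(f, α) ≠ 0`
(`coeff_one_padicLFunction_ne_zero_of_riemannSum_lt`, the measure bound being free), hence
Schneider's non-degeneracy for every canonical height datum (`Leaf.schneider_of_coeff_one_ne_zero`).
[cite: SteinWuthrich2013, §3 Prop. 3.5] [cite: PerrinRiou1987, §1.4 Cor. 1.8] -/
theorem Leaf.schneider_of_riemannSum_lt (hPR : perrinRiou_rankOne_leadingTerms_odd)
    (hGZK : rank_eq_analyticRank_of_analyticRank_le_one) (h : Leaf W p) {N : ℕ} [NeZero N]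
    (f : CuspForm (Gamma0 N) 2) (hf : IsNewformOf W f) {n : ℕ}
    (hlt : (p : ℝ) ^ (-n : ℤ) < ‖padicLRiemannSum f (unitRoot W p : ℚ_[p]) 1 n‖) :
    ∀ Dh : PAdicHeightData W p, Dh.IsCanonical → SchneiderConjecture Dh :=
  h.schneider_of_coeff_one_ne_zero hPR hGZK f hf
    (coeff_one_padicLFunction_ne_zero_of_riemannSum_lt (by have := h.two_lt; omega)
      h.isOrdinaryAt hf h.analyticRank_eq_one hlt)

/-- **Per pair, one inequality: `p ∤ #Ш(E/ℚ)_an` + `p⁻ⁿ < ‖RS(1, n)‖_p` ⇒ BOTH Mazur's main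
conjecture and `BSD(E,p)`** at a rank-one leaf pair — x1a's
`Leaf.mazurMainConjecture_and_bsdp_of_shaAn_unit_of_coeff_one_ne_zero` with `hcoeff` from the
one-hypothesis certificate. PUBLISHED binders only (Wuthrich Thm. 16, Perrin-Riou–Schneider,
Perrin-Riou 1987, Mazur–Tate sigma, modularity, GZK). [cite: Wuthrich2014, Thm. 16 (p. 397)]
[cite: BalakrishnanMullerStein2015, Thm. 1.7] [cite: PerrinRiou1987, §1.4 Cor. 1.8]
[cite: SteinWuthrich2013, §3 Prop. 3.5] [cite: Miller2011LMS, Def. 1.1 (arXiv:1010.2431 p. 3)] -/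
theorem Leaf.mazurMainConjecture_and_bsdp_of_shaAn_unit_of_riemannSum_lt
    (hW16 : Wuthrich2014.charIdeal_dvd_padicLFunction) (hS : Schneider1985_order_charGenerator_odd)
    (hPR : perrinRiou_rankOne_leadingTerms_odd) (hMT : mazur_tate_sigma_exists_odd)
    (hmod : nonempty_modularParametrizationData) (hGZK : rank_eq_analyticRank_of_analyticRank_le_one)
    (h : Leaf W p) {N : ℕ} [NeZero N] (f : CuspForm (Gamma0 N) 2) (hf : IsNewformOf W f) {n : ℕ}
    (hlt : (p : ℝ) ^ (-n : ℤ) < ‖padicLRiemannSum f (unitRoot W p : ℚ_[p]) 1 n‖)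
    (hunit : ∃ q : ℚ, shaAn W = (q : ℂ) ∧ padicValRat p q = 0) :
    MazurMainConjecture W p ∧ BSDp W p :=
  h.mazurMainConjecture_and_bsdp_of_shaAn_unit_of_coeff_one_ne_zero hW16 hS hPR hMT hmod hGZK f hf
    (coeff_one_padicLFunction_ne_zero_of_riemannSum_lt (by have := h.two_lt; omega)
      h.isOrdinaryAt hf h.analyticRank_eq_one hlt) hunit

/-- **`BSD(E,p)` half** of the preceding theorem. [cite: Wuthrich2014, Thm. 16 (p. 397)]
[cite: PerrinRiou1987, §1.4 Cor. 1.8] [cite: SteinWuthrich2013, §3 Prop. 3.5] -/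
theorem Leaf.bsdp_of_shaAn_unit_of_riemannSum_lt
    (hW16 : Wuthrich2014.charIdeal_dvd_padicLFunction) (hS : Schneider1985_order_charGenerator_odd)
    (hPR : perrinRiou_rankOne_leadingTerms_odd) (hMT : mazur_tate_sigma_exists_odd)
    (hmod : nonempty_modularParametrizationData) (hGZK : rank_eq_analyticRank_of_analyticRank_le_one)
    (h : Leaf W p) {N : ℕ} [NeZero N] (f : CuspForm (Gamma0 N) 2) (hf : IsNewformOf W f) {n : ℕ}
    (hlt : (p : ℝ) ^ (-n : ℤ) < ‖padicLRiemannSum f (unitRoot W p : ℚ_[p]) 1 n‖)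
    (hunit : ∃ q : ℚ, shaAn W = (q : ℂ) ∧ padicValRat p q = 0) : BSDp W p :=
  (h.mazurMainConjecture_and_bsdp_of_shaAn_unit_of_riemannSum_lt hW16 hS hPR hMT hmod hGZK f hf hlt
    hunit).2

/-- **Booking form along the isogeny class, one inequality:** leaf pair `(E, p)`, one level `n`
with `p⁻ⁿ < ‖RS(1, n)‖_p` for a newform `f` of `E`, and `p ∤ #Ш(E′)_an` for SOME globally minimal
`E′ ∼ E` ⇒ `BSD(E,p)` — x1a's `Leaf.bsdp_of_coeff_one_ne_zero_of_isIsogenous_shaAn_unit` (Cassels)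
with `hcoeff` from the one-hypothesis certificate. [cite: Wuthrich2014, Thm. 16 (p. 397)]
[cite: PerrinRiou1987, §1.4 Cor. 1.8] [cite: MilneADT2006, Thm. I.7.3]
[cite: SteinWuthrich2013, §3 Prop. 3.5] -/
theorem Leaf.bsdp_of_riemannSum_lt_of_isIsogenous_shaAn_unit
    (hW16 : Wuthrich2014.charIdeal_dvd_padicLFunction) (hS : Schneider1985_order_charGenerator_odd)
    (hPR : perrinRiou_rankOne_leadingTerms_odd) (hMT : mazur_tate_sigma_exists_odd)
    (hmod : nonempty_modularParametrizationData) (hmod' : hasEntireLFunction_rat)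
    (hGZK : rank_eq_analyticRank_of_analyticRank_le_one) (hCassels : bsdRHS_eq_of_isIsogenous)
    (h : Leaf W p) {N : ℕ} [NeZero N] (f : CuspForm (Gamma0 N) 2) (hf : IsNewformOf W f) {n : ℕ}
    (hlt : (p : ℝ) ^ (-n : ℤ) < ‖padicLRiemannSum f (unitRoot W p : ℚ_[p]) 1 n‖)
    {W' : WeierstrassCurve ℚ} [W'.IsElliptic] [W'.IsGloballyMinimal] (hiso : IsIsogenous W W')
    (hunit : ∃ q : ℚ, shaAn W' = (q : ℂ) ∧ padicValRat p q = 0) : BSDp W p :=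
  h.bsdp_of_coeff_one_ne_zero_of_isIsogenous_shaAn_unit hW16 hS hPR hMT hmod hmod' hGZK hCassels f hf
    (coeff_one_padicLFunction_ne_zero_of_riemannSum_lt (by have := h.two_lt; omega)
      h.isOrdinaryAt hf h.analyticRank_eq_one hlt) hiso hunit

end Summit.BirchSwinnertonDyer.Rank1Residual.X1.RankOne

end
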